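import Summits.QuantumFields.GaugeBoot.HaarConjugationMoments
import Summits.QuantumFields.GaugeBoot.HolonomyGauge
import Summits.QuantumFields.GaugeBoot.GaugeGroupSchurAverages
import HarnessLib

/-!
# Gauge averages of polynomials in closed-word holonomies are multi-trace Wilson loops (gauge-boot, FFT 7/8)

HONEST FRAMING (cell `pub-gaugeboot`, page 1 of every file): the venture produces certified bounds
on lattice expectations at stated coupling, gauge group, dimension and torus size; NOT a mass gap,
NOT a continuum limit, NOT a string tension; NOT Yang–Mills-summit-bearing (barriers
`FixedCouplingUltralocality`, `PerturbativeInvisibility`). Structural; no number is certified.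
Seventh brick of the lane's first fundamental theorem for lattice gauge invariants: the GAUGE
AVERAGE of a polynomial in the entries of closed-word holonomies at the base point is a polynomial
in Wilson loops — combining the Weingarten form of the Haar conjugation moments
(`HaarConjugationMoments`) with the slot elimination of twisted traces (`TwistedTraceLoops`).

## Content (torus `(ℤ/L)^d`, compact `G`, `r : LatticeRep G` with `SU(N) ⊆ ρ(G)`, `N ≥ 1`)

* `containsSU_suN`, `containsSU_uN` — the defining representations of `SU(N)` and `U(N)` qualify.
* `gaugeAvgC F U = ∫ F(U^γ) dγ` — the gauge average of a complex observable (product Haar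
  probability on the gauge group `(ℤ/L)^d → G`); `gaugeAvgC_of_isGaugeInvariant`.
* `integral_gaugeGroup_eval` — a function of the gauge transformation at ONE site integrates over
  the gauge group as a Haar integral over `G` (`haarProbability_pi`, Mathlib `measurePreserving_eval`).
* ★★ `exists_mem_loopAlgebraC_gaugeAvgC_prod` — for closed words `w_i` at `0`:
  `U ↦ ∫ ∏_i ρ(hol_0 w_i (U^γ))_{a_i b_i} dγ` lies in the Wilson loop algebra at `0` (gauge
  covariance makes the integrand `∏_i (ρ(γ₀) ρ(hol_0 w_i U) ρ(γ₀)⁻¹)_{a_i b_i}`; Weingarten form;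
  twisted traces are loops).
* ★★ `exists_mem_loopAlgebraC_gaugeAvgC` — hence the gauge average of every element of the line
  algebra `lineAlgebraC r 0` is (the function of) an element of `loopAlgebraC r 0`.
* ★★★ `mem_loopAlgebraC_of_isGaugeInvariant` — FIRST FUNDAMENTAL THEOREM, complex form: a
  gauge-invariant complex polynomial observable (`polyAlgebraC r`) IS a polynomial in the Wilson
  loops `tr ρ(hol_0 w)`, `w` closed at `0` (holonomy gauge `HolonomyGauge` + the above).

References: B. Durhuus, Lett. Math. Phys. 4 (1980) 515–522; A. Sengupta, Proc. AMS 121 (1994)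
897–905, Thm. 2. Not in Mathlib.
-/

noncomputable section

namespace Summit.QuantumFields.GaugeBoot

open MeasureTheory Matrix Finset TensorFFT
open Literature.MathematicalPhysics.QuantumFieldTheory (Site Edge GaugeConfig LatticeRep gaugeTransform
  IsGaugeInvariant haarProbability)
open Literature.MathematicalPhysics.QuantumLattice (fundamentalLatticeRep unitaryFundamentalLatticeRep)

/-! ## Instances of `ContainsSU` -/

/-- The defining representation of `SU(N)` contains `SU(N)`. -/
theorem containsSU_suN (N : ℕ) : ContainsSU (fundamentalLatticeRep N) := fun s hs => ⟨⟨s, hs⟩, rfl⟩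

/-- The defining representation of `U(N)` contains `SU(N)`. -/
theorem containsSU_uN (N : ℕ) : ContainsSU (unitaryFundamentalLatticeRep N) := fun s hs =>
  ⟨⟨s, (Matrix.mem_specialUnitaryGroup_iff.1 hs).1⟩, rfl⟩

variable {d L : ℕ} [NeZero L] {G : Type*} [Group G] [TopologicalSpace G] [IsTopologicalGroup G]
  [CompactSpace G] [MeasurableSpace G] [BorelSpace G] [SecondCountableTopology G] (r : LatticeRep G)

/-! ## The gauge average of a complex observable -/

section Avg

omit r

omit [NeZero L] [CompactSpace G] [MeasurableSpace G] [BorelSpace G] [SecondCountableTopology G] in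
/-- `γ ↦ U^γ` is continuous. -/
theorem continuous_gaugeTransform_left (U : GaugeConfig d L G) :
    Continuous fun γ : Site d L → G => gaugeTransform γ U :=
  continuous_pi fun e => (((continuous_apply e.1).mul continuous_const).mul
    (continuous_apply (e.1.shift e.2)).inv)

/-- **The gauge average** `∫ F(U^γ) dγ` of a complex observable (as a function). [folklore] -/
def gaugeAvgC (F : C(GaugeConfig d L G, ℂ)) (U : GaugeConfig d L G) : ℂ :=
  ∫ γ, F (gaugeTransform γ U) ∂haarProbability (Site d L → G)

/-- `gaugeAvgC` unfolded. -/
theorem gaugeAvgC_def (F : C(GaugeConfig d L G, ℂ)) (U : GaugeConfig d L G) :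
    gaugeAvgC F U = ∫ γ, F (gaugeTransform γ U) ∂haarProbability (Site d L → G) := rfl

/-- The averaged integrand is integrable. -/
theorem integrable_comp_gaugeTransform (F : C(GaugeConfig d L G, ℂ)) (U : GaugeConfig d L G) :
    Integrable (fun γ : Site d L → G => F (gaugeTransform γ U)) (haarProbability (Site d L → G)) :=
  (F.continuous.comp (continuous_gaugeTransform_left U)).integrable_of_hasCompactSupport
    (HasCompactSupport.of_compactSpace _)

/-- `gaugeAvgC` is additive. -/
theorem gaugeAvgC_add (F₁ F₂ : C(GaugeConfig d L G, ℂ)) (U : GaugeConfig d L G) :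
    gaugeAvgC (F₁ + F₂) U = gaugeAvgC F₁ U + gaugeAvgC F₂ U := by
  simp only [gaugeAvgC_def, ContinuousMap.add_apply]
  exact integral_add (integrable_comp_gaugeTransform F₁ U) (integrable_comp_gaugeTransform F₂ U)

/-- `gaugeAvgC` is homogeneous. -/
theorem gaugeAvgC_smul (c : ℂ) (F : C(GaugeConfig d L G, ℂ)) (U : GaugeConfig d L G) :
    gaugeAvgC (c • F) U = c * gaugeAvgC F U := by
  simp only [gaugeAvgC_def, ContinuousMap.smul_apply, smul_eq_mul]
  exact integral_const_mul c _

/-- `gaugeAvgC 0 = 0`. -/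
theorem gaugeAvgC_zero (U : GaugeConfig d L G) : gaugeAvgC (0 : C(GaugeConfig d L G, ℂ)) U = 0 := by
  simp [gaugeAvgC_def]

/-- **The gauge average of a gauge-invariant observable is the observable.** -/
theorem gaugeAvgC_of_isGaugeInvariant {F : C(GaugeConfig d L G, ℂ)} (hF : IsGaugeInvariant (⇑F))
    (U : GaugeConfig d L G) : gaugeAvgC F U = F U := by
  simp only [gaugeAvgC_def, hF _ U, integral_const, probReal_univ, one_smul]

/-- ★ **A function of the gauge transformation at one site integrates as a Haar integral over `G`.** -/
theorem integral_gaugeGroup_eval (x : Site d L) (Φ : G → ℂ) (hΦ : Continuous Φ) :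
    ∫ γ, Φ (γ x) ∂haarProbability (Site d L → G) = ∫ g, Φ g ∂haarProbability G := by
  rw [haarProbability_pi]
  have h := (measurePreserving_eval (fun _ : Site d L => haarProbability G) x).map_eq
  conv_rhs => rw [← h]
  rw [integral_map (measurable_pi_apply x).aemeasurable hΦ.aestronglyMeasurable]

end Avg

/-! ## Gauge averages of products of closed-word line entries -/

section Prod

variable {r}

/-- ★★ **Gauge averages of products of closed-word line entries are multi-trace Wilson loops**:
for closed words `w_i` at `0` and indices `a_i, b_i`, the function
`U ↦ ∫ ∏_i ρ(hol_0 w_i (U^γ))_{a_i b_i} dγ` is an element of the Wilson loop algebra at `0`. -/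
theorem exists_mem_loopAlgebraC_gaugeAvgC_prod (hSU : ContainsSU r) (hN : 0 < r.N) {p : ℕ}
    (w : Fin p → Word d) (hw : ∀ i, Word.endpoint (0 : Site d L) (w i) = 0) (a b : Fin p → Fin r.N) :
    ∃ H ∈ loopAlgebraC (d := d) (L := L) r 0, ∀ U : GaugeConfig d L G,
      H U = ∫ γ, ∏ i, r.ρ (wordHolonomy (gaugeTransform γ U) 0 (w i)) (a i) (b i)
        ∂haarProbability (Site d L → G) := by
  obtain ⟨W, hW⟩ := exists_integral_prod_conj_eq (κ := Fin p) hSU hN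
  -- the twisted traces as loop-algebra elements
  have hT : ∀ τ : Equiv.Perm (Fin p), ∃ F ∈ loopAlgebraC (d := d) (L := L) r 0,
      ∀ U : GaugeConfig d L G, F U = twistTrace τ (fun i => r.ρ (wordHolonomy U 0 (w i))) :=
    fun τ => exists_mem_loopAlgebraC_twistTrace r 0 p τ w hw
  choose F hF hFU using hT
  refine ⟨∑ σ : Equiv.Perm (Fin p), ∑ τ : Equiv.Perm (Fin p),
      (W σ τ * (permMat σ : Matrix (Fin p → Fin r.N) (Fin p → Fin r.N) ℂ) a b) • F τ,
    Subalgebra.sum_mem _ fun σ _ => Subalgebra.sum_mem _ fun τ _ => Subalgebra.smul_mem _ (hF τ) _,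
    fun U => ?_⟩
  -- gauge covariance of the closed-word holonomies
  have hcov : ∀ γ : Site d L → G, (∏ i, r.ρ (wordHolonomy (gaugeTransform γ U) 0 (w i)) (a i) (b i)) =
      ∏ i, (r.ρ (γ 0) * r.ρ (wordHolonomy U 0 (w i)) * r.ρ (γ 0)⁻¹) (a i) (b i) := by
    intro γ
    refine prod_congr rfl fun i _ => ?_
    rw [rho_wordHolonomy_gaugeTransform r γ U 0 (w i), hw i]
  simp_rw [hcov]
  have hc : Continuous fun g : G => ∏ i, (r.ρ g * r.ρ (wordHolonomy U 0 (w i)) * r.ρ g⁻¹) (a i) (b i) :=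
    continuous_finsetProd _ fun i _ =>
      ((r.continuous.mul continuous_const).mul (r.continuous.comp continuous_inv)).matrix_elem (a i) (b i)
  rw [integral_gaugeGroup_eval (0 : Site d L) _ hc, hW (fun i => r.ρ (wordHolonomy U 0 (w i))) a b]
  simp only [ContinuousMap.coe_sum, ContinuousMap.coe_smul, Finset.sum_apply, Pi.smul_apply,
    smul_eq_mul, hFU]

omit [NeZero L] [CompactSpace G] [MeasurableSpace G] [BorelSpace G] [SecondCountableTopology G] in
/-- Elements of the submonoid generated by the closed-word line entries are products of such
entries (with the empty product for `1`). -/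
theorem exists_prod_of_mem_closure {m : C(GaugeConfig d L G, ℂ)}
    (hm : m ∈ Submonoid.closure
      {f | ∃ (w : Word d) (a b : Fin r.N), Word.endpoint (0 : Site d L) w = 0 ∧ f = lineC r 0 w a b}) :
    ∃ (p : ℕ) (w : Fin p → Word d) (a b : Fin p → Fin r.N), (∀ i, Word.endpoint (0 : Site d L) (w i) = 0) ∧
      ∀ U : GaugeConfig d L G, m U = ∏ i, r.ρ (wordHolonomy U 0 (w i)) (a i) (b i) := by
  induction hm using Submonoid.closure_induction with
  | mem f hf =>
    obtain ⟨w, a, b, hw, rfl⟩ := hf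
    exact ⟨1, fun _ => w, fun _ => a, fun _ => b, fun _ => hw, fun U => by simp⟩
  | one => exact ⟨0, Fin.elim0, Fin.elim0, Fin.elim0, fun i => i.elim0, fun U => by simp⟩
  | mul f g _ _ ihf ihg =>
    obtain ⟨p, w, a, b, hw, hf⟩ := ihf
    obtain ⟨q, w', a', b', hw', hg⟩ := ihg
    refine ⟨p + q, Fin.append w w', Fin.append a a', Fin.append b b', fun i => ?_, fun U => ?_⟩
    · refine Fin.addCases (fun i => ?_) (fun i => ?_) i
      · simp only [Fin.append_left, hw]
      · simp only [Fin.append_right, hw']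
    · rw [ContinuousMap.mul_apply, hf, hg, Fin.prod_univ_add]
      simp only [Fin.append_left, Fin.append_right]

/-- ★★ **The gauge average of every element of the line algebra at `0` is a multi-trace Wilson
loop**: `gaugeAvgC F = ⇑H` for some `H ∈ loopAlgebraC r 0`. -/
theorem exists_mem_loopAlgebraC_gaugeAvgC (hSU : ContainsSU r) (hN : 0 < r.N)
    {F : C(GaugeConfig d L G, ℂ)} (hF : F ∈ lineAlgebraC (d := d) (L := L) r 0) :
    ∃ H ∈ loopAlgebraC (d := d) (L := L) r 0, ∀ U : GaugeConfig d L G, H U = gaugeAvgC F U := by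
  have hF' : F ∈ Subalgebra.toSubmodule (lineAlgebraC (d := d) (L := L) r 0) := hF
  rw [lineAlgebraC, Algebra.adjoin_eq_span] at hF'
  clear hF
  refine Submodule.span_induction (p := fun f _ => ∃ H ∈ loopAlgebraC (d := d) (L := L) r 0,
    ∀ U : GaugeConfig d L G, H U = gaugeAvgC f U) ?_ ?_ ?_ ?_ hF'
  · intro m hm
    obtain ⟨p, w, a, b, hw, hmU⟩ := exists_prod_of_mem_closure hm
    obtain ⟨H, hH, hHU⟩ := exists_mem_loopAlgebraC_gaugeAvgC_prod hSU hN w hw a b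
    refine ⟨H, hH, fun U => ?_⟩
    rw [hHU, gaugeAvgC_def]
    simp only [hmU]
  · exact ⟨0, Subalgebra.zero_mem _, fun U => by rw [gaugeAvgC_zero]; rfl⟩
  · intro f g _ _ ihf ihg
    obtain ⟨H₁, h₁, h₁U⟩ := ihf
    obtain ⟨H₂, h₂, h₂U⟩ := ihg
    exact ⟨H₁ + H₂, Subalgebra.add_mem _ h₁ h₂, fun U => by
      rw [ContinuousMap.add_apply, h₁U, h₂U, gaugeAvgC_add]⟩
  · intro c f _ ih
    obtain ⟨H, h, hU⟩ := ih
    exact ⟨c • H, Subalgebra.smul_mem _ h c, fun U => by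
      rw [ContinuousMap.smul_apply, hU, gaugeAvgC_smul, smul_eq_mul]⟩

/-- ★★★ **FIRST FUNDAMENTAL THEOREM for lattice gauge invariants (complex form)**: on the torus
`(ℤ/L)^d` with a compact gauge group whose image contains `SU(N)` (`SU(N)`, `U(N)` in the defining
representation), every GAUGE-INVARIANT complex polynomial observable in the link variables is a
polynomial in the Wilson loops `tr ρ(hol_0 w)`, `w` closed at the base point — it lies in
`loopAlgebraC r 0`. (Durhuus 1980; Sengupta 1994, Thm. 2.) -/
theorem mem_loopAlgebraC_of_isGaugeInvariant (hSU : ContainsSU r) (hN : 0 < r.N)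
    {F : C(GaugeConfig d L G, ℂ)} (hF : F ∈ polyAlgebraC (d := d) (L := L) r)
    (hFi : IsGaugeInvariant (⇑F)) : F ∈ loopAlgebraC (d := d) (L := L) r 0 := by
  obtain ⟨H, hH, hHU⟩ := exists_mem_loopAlgebraC_gaugeAvgC hSU hN
    (mem_lineAlgebraC_of_isGaugeInvariant r hF hFi)
  have e : F = H := ContinuousMap.ext fun U => by rw [hHU, gaugeAvgC_of_isGaugeInvariant hFi]
  rw [e]
  exact hH

end Prod

end Summit.QuantumFields.GaugeBoot

end
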